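import Summits.BirchSwinnertonDyer.Rank1Residual.X5.TwoAdicTargetsAlphaEnd
import Literature.NumberTheory.EllipticCurves.PAdicLFunctionIntegralityAtTwoAutoProofs
import HarnessLib

/-!
# Class O1 (X5, `p = 2`, non-CM): INT2-AUTO discharges the Néron-integrality certificate `hint`
# of the α-go END-STATE down to the `2`-adic valuation of ONE period ratio

HONEST FRAMING (cell `b2b-bsdres`, run/shared/lean/b2b/bsd-rank1-residual/, verbatim in every
file): the goal of the cell is to DELETE the COMBINATION-SHAPED residual classes of the
Birch–Swinnerton-Dyer formula for ALL analytic-rank `≤ 1` elliptic curves over `ℚ` — "full BSD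
formula for every rank `≤ 1` curve in class `C`" assembled STRICTLY from published theorems — so
that the rank-`≤ 1` remainder becomes exactly the CONSTRUCTION-SHAPED classes, which are TYPED
(missing-input `Prop`s), NOT attempted. This is not "finishing BSD". Research routes; no claim
beyond stated classes; census output = EVIDENCE, never a Literature fact; nothing here is booked;
no mark of RESIDUAL-MAP §I moves.

Unit `b2b-bsdres-cc-typer-4` (lane CLASS-CLOSURE, class O1), gen 3, o1 lead GEN 10 item (12)
"INT2-AUTO" (lens-1 GEN 4, G4.1, `HOME/cells/o1/ROUTES-O1.md` l.1150). The Literature theorem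
`exists_iwasawaToPowerSeries_eq_padicLFunction_two_auto`
(`Literature/NumberTheory/EllipticCurves/PAdicLFunctionIntegralityAtTwoAutoProofs.lean`, this
lineage, PROVED): for EVERY `E = W/ℚ` globally minimal and good ORDINARY at `2`, with newform `f`,
`L₂(f, α, T) ∈ Λ = ℤ₂⟦T⟧` in the `f`-normalisation (`Ω⁺_f`, `Δ = {±1}`, `γ = 5`) — no hypothesis on
`E[2]`, the `2`-adic image or the Manin constant (the Hecke operator `T₂` supplies the Eisenstein
multiple: `(a₂ − 3)[0]⁺ ∈ ½ℤ`, `(α − 1)(α − 2) = (a₂ − 3)α`). CONSEQUENCE for the α-go END-STATE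
(`X5/TwoAdicTargetsAlphaEnd.lean`): its per-curve certificate binder
`hint : ∀ f, IsNewformOf W f → ∀ ϖ, ϖ · Ω_W = Ω⁺_f → ∃ L₀, ι L₀ = ϖ · L₂(f, α)` is DISCHARGED by the
single inequality `0 ≤ ord₂ ϖ` ("`Ω_W` divides `Ω⁺_f` `2`-adically"), and its slack-`k` variant by
`−k ≤ ord₂ ϖ`. THEOREMS ONLY; no new target, no new fact.

* `exists_integral_mul_padicLFunction_two_of_padicValRat_nonneg` (PROVED): good ordinary `2`,
  `f` the newform of `W`, `0 ≤ ord₂ ϖ` ⇒ `∃ L₀ : Λ, ι L₀ = ϖ · L₂(f, α)`.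
* `exists_integral_mul_padicLFunction_two_of_slack` (PROVED): a period ratio `ϖ` with `−m ≤ ord₂ ϖ` ⇒
  the slack-`m` certificate with `ϖ′ = 2^m ϖ`.
* `missingUpperBoundAt_two_of_mu_eq_zero_auto`, `missingUpperBoundAt_two_of_prop514_auto`,
  `bsdp_two_of_prop514_of_lowerBound_auto` (PROVED): the α-go END-STATE with `hint` replaced by
  `hper₀ : ∀ f ϖ, ϖ · Ω_W = Ω⁺_f → 0 ≤ ord₂ ϖ`. On the Prop. 5.14 locus the remaining per-pair inputs
  are therefore: PRINT {Greenberg 5.14@2, 4.1@2, modularity, GZK, Kato 17.4 (1)(2)@2}, the period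
  inequality `hper₀` (lens-1 G4.4: `s* = 0` on 237/237 classes reduces it to "`Ω⁺_f = Ω(E₀)` up to a
  `2`-adic unit ∧ `Ω(E₀) ∣₂ Ω_W`" — Manin constant odd, `X₀`-optimality; EVIDENCE, not used), and the
  lower half `MissingLowerBoundAt W 2`.
* `upperBoundAtTwo_of_mu_eq_zero_of_slack_auto`, `bsdp_two_of_mu_eq_zero_of_slack_one_auto` (PROVED):
  the slack versions with `hper_m : −m ≤ ord₂ ϖ`.

CAVEAT carried from the Literature file (lens-1 G4.8; refuter MTT §§I.13–18 page-check pending): the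
integrality is for the tree's `padicLFunction f α` (Riemann sums over both elements of `Δ = {±1}`);
it is EXACTLY the object consumed by `kato_divisibility_allPrimes` / `upperBound_two_of_mu_eq_zero`
here, so the discharge below is unconditional regardless of how the printed normalisation is read.
-/

set_option autoImplicit false

noncomputable section

open scoped Classical MatrixGroups ModularForm

open CongruenceSubgroup WeierstrassCurve Literature.NumberTheory.EllipticCurves
  Literature.NumberTheory.EllipticCurves.ModularForms
  Literature.NumberTheory.EllipticCurves.Wuthrich2014
  Literature.NumberTheory.EllipticCurves.Rank1Residual
  Literature.NumberTheory.EllipticCurves.Rank1Residual.Typed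
  Literature.NumberTheory.EllipticCurves.Greenberg1999

namespace Summit.BirchSwinnertonDyer.Rank1Residual.X5.O1

variable (W : WeierstrassCurve ℚ) [W.IsElliptic] [W.IsGloballyMinimal]

/-! ## §1 INT2-AUTO ⇒ the certificate `ι L₀ = ϖ · L₂(f, α)` from `0 ≤ ord₂ ϖ` -/

/-- **The Néron-integrality certificate from one inequality (PROVED).** `E = W` good ordinary at `2`,
`f` its newform (any level), `ϖ ∈ ℚ` with `0 ≤ ord₂ ϖ`: `∃ L₀ : Λ, ι L₀ = ϖ · L₂(f, α)` — `L₂(f, α) = ι G`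
unconditionally (`exists_iwasawaToPowerSeries_eq_padicLFunction_two_auto`) and `ϖ ∈ ℤ₂`, so
`L₀ = ϖ G`. [cite: MazurTateTeitelbaum1986Invent, §I.12] -/
theorem exists_integral_mul_padicLFunction_two_of_padicValRat_nonneg (hord : IsOrdinaryAt W 2)
    {N : ℕ} [NeZero N] {f : CuspForm (Gamma0 N) 2} (hf : IsNewformOf W f) {ϖ : ℚ}
    (hϖ : 0 ≤ padicValRat 2 ϖ) :
    ∃ L₀ : IwasawaAlgebra 2, iwasawaToPowerSeries 2 L₀ =
      PowerSeries.C (ϖ : ℚ_[2]) * padicLFunction f (unitRoot W 2 : ℚ_[2]) := by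
  obtain ⟨G, hG⟩ := exists_iwasawaToPowerSeries_eq_padicLFunction_two_auto hord hf
  have hnorm : ‖((ϖ : ℚ) : ℚ_[2])‖ ≤ 1 := by
    by_cases h0 : ϖ = 0
    · subst h0; simp
    have hϖQ : ((ϖ : ℚ) : ℚ_[2]) ≠ 0 := by exact_mod_cast h0
    rw [Padic.norm_eq_zpow_neg_valuation hϖQ, Padic.valuation_ratCast]
    exact zpow_le_one_of_nonpos₀ (by norm_num) (by linarith)
  let ϖ₀ : ℤ_[2] := ⟨((ϖ : ℚ) : ℚ_[2]), hnorm⟩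
  refine ⟨(PowerSeries.C ϖ₀ : IwasawaAlgebra 2) * G, ?_⟩
  rw [map_mul, hG, iwasawaToPowerSeries, PowerSeries.map_C]
  rfl

/-- **The slack-`m` certificate from `−m ≤ ord₂ ϖ` (PROVED).** For a period ratio `ϖ`
(`ϖ · Ω_W = Ω⁺_f`, hence `ϖ ≠ 0` as `Ω⁺_f > 0`) with `−m ≤ ord₂ ϖ`, and `ϖ′ = 2^m ϖ`:
`ϖ′ ≠ 0`, `ord₂ ϖ′ ≤ ord₂ ϖ + m`, `∃ L₀, ι L₀ = ϖ′ · L₂(f, α)`. [cite: MazurTateTeitelbaum1986Invent, §I.12] -/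
theorem exists_integral_mul_padicLFunction_two_of_slack (hord : IsOrdinaryAt W 2)
    {N : ℕ} [NeZero N] {f : CuspForm (Gamma0 N) 2} (hf : IsNewformOf W f) {ϖ : ℚ}
    (hϖeq : (ϖ : ℝ) * W.realPeriodRat = plusPeriod f) (m : ℕ) (hϖ : -(m : ℤ) ≤ padicValRat 2 ϖ) :
    ∃ (ϖ' : ℚ) (L₀ : IwasawaAlgebra 2), ϖ' ≠ 0 ∧ padicValRat 2 ϖ' ≤ padicValRat 2 ϖ + m ∧
      iwasawaToPowerSeries 2 L₀ =
        PowerSeries.C (ϖ' : ℚ_[2]) * padicLFunction f (unitRoot W 2 : ℚ_[2]) := by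
  have hϖ0 : ϖ ≠ 0 := by
    rintro rfl
    have hper : 0 < plusPeriod f := IsNewform0.plusPeriod_pos_holds hf.1 hf.coeffField_eq_bot
    rw [← hϖeq, Rat.cast_zero, zero_mul] at hper
    exact lt_irrefl _ hper
  have h20 : (2 : ℚ) ^ m ≠ 0 := pow_ne_zero _ two_ne_zero
  have h22 : padicValRat 2 2 = 1 := by
    have h := padicValRat.self (p := 2) (by norm_num)
    exact_mod_cast h
  have hval : padicValRat 2 (2 ^ m * ϖ) = m + padicValRat 2 ϖ := by
    rw [padicValRat.mul h20 hϖ0, padicValRat.pow (2 : ℚ), h22]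
    ring
  obtain ⟨L₀, hL₀⟩ := exists_integral_mul_padicLFunction_two_of_padicValRat_nonneg W hord hf
    (ϖ := 2 ^ m * ϖ) (by rw [hval]; linarith)
  refine ⟨2 ^ m * ϖ, L₀, mul_ne_zero h20 hϖ0, by rw [hval]; linarith, ?_⟩
  rw [hL₀]

/-! ## §2 The α-go END-STATE with `hint` discharged -/

/-- **`MissingUpperBoundAt W 2` from `μ = 0`, with the certificate discharged (PROVED).** As
`missingUpperBoundAt_two_of_mu_eq_zero` (rank `0`, good ordinary `2`; PRINT: Greenberg 4.1@2 `hEC`,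
modularity, GZK, Kato 17.4 (1)(2)@2; `μ = 0` for the cyclotomic data), with `hint` replaced by the
inequality `hper₀ : 0 ≤ ord₂ ϖ` for the period ratios of the newform at level `N_E` (INT2-AUTO).
[cite: Kato2004Asterisque, Thm. 17.4 (1)(2) (p. 273)] [cite: Miller2011LMS, Def. 1.1]
[cite: MazurTateTeitelbaum1986Invent, §I.12] -/
theorem missingUpperBoundAt_two_of_mu_eq_zero_auto (hEC : TwoAdicEulerCharRankZero W 0)
    (hmod : nonempty_modularParametrizationData)
    (hGZK : rank_eq_analyticRank_of_analyticRank_le_one)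
    (h17 : ∀ [NeZero (W.conductorNorm ℤ)] (f : CuspForm (Gamma0 (W.conductorNorm ℤ)) 2),
      kato_divisibility_allPrimes W 2 (f := f))
    (hμ : ∀ (κ : ZpExtension ℚ 2) (γ : Field.absoluteGaloisGroup ℚ), κ.IsCyclotomic →
      κ.IsTopGenerator γ → IsCyclotomicVariable 2 γ → ∀ D : W.SelmerDualData κ γ, D.mu = 0)
    (hper₀ : ∀ [NeZero (W.conductorNorm ℤ)] (f : CuspForm (Gamma0 (W.conductorNorm ℤ)) 2),
      IsNewformOf W f → ∀ ϖ : ℚ, (ϖ : ℝ) * W.realPeriodRat = plusPeriod f → 0 ≤ padicValRat 2 ϖ)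
    (hr : W.analyticRank = 0) (hgo : GoodOrd W 2) : MissingUpperBoundAt W 2 :=
  missingUpperBoundAt_two_of_mu_eq_zero W hEC hmod hGZK h17 hμ
    (fun f hf ϖ hϖ =>
      exists_integral_mul_padicLFunction_two_of_padicValRat_nonneg W hgo hf (hper₀ f hf ϖ hϖ))
    hr hgo

/-- **α-go: `MissingUpperBoundAt W 2` on the Greenberg Prop. 5.14 locus, certificate discharged
(PROVED modulo PUBLISHED named facts and the period inequality).** As
`missingUpperBoundAt_two_of_prop514` with `hint` replaced by `hper₀ : 0 ≤ ord₂ ϖ`.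
[cite: GreenbergLNM1716, Prop. 5.14 (p. 121) and Thm. 4.1 (p. 102)]
[cite: Kato2004Asterisque, Thm. 17.4 (1)(2) (p. 273)] [cite: MazurTateTeitelbaum1986Invent, §I.12] -/
theorem missingUpperBoundAt_two_of_prop514_auto (h514 : prop514_isTorsion_mu_eq_zero_two)
    (hEC : TwoAdicEulerCharRankZero W 0) (hmod : nonempty_modularParametrizationData)
    (hGZK : rank_eq_analyticRank_of_analyticRank_le_one)
    (h17 : ∀ [NeZero (W.conductorNorm ℤ)] (f : CuspForm (Gamma0 (W.conductorNorm ℤ)) 2),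
      kato_divisibility_allPrimes W 2 (f := f))
    (hper₀ : ∀ [NeZero (W.conductorNorm ℤ)] (f : CuspForm (Gamma0 (W.conductorNorm ℤ)) 2),
      IsNewformOf W f → ∀ ϖ : ℚ, (ϖ : ℝ) * W.realPeriodRat = plusPeriod f → 0 ≤ padicValRat 2 ϖ)
    (hr : W.analyticRank = 0) (hgo : GoodOrd W 2) {x y : ℚ} (hP : W.toAffine.Equation x y)
    (h2 : 2 * y + W.a₁ * x + W.a₃ = 0)
    (hΦ : (TwoTorsionRamifiedAtTwo x ∧ ¬ TwoTorsionOdd W x) ∨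
      (TwoTorsionOdd W x ∧ ¬ TwoTorsionRamifiedAtTwo x)) : MissingUpperBoundAt W 2 :=
  missingUpperBoundAt_two_of_prop514 W h514 hEC hmod hGZK h17
    (fun f hf ϖ hϖ =>
      exists_integral_mul_padicLFunction_two_of_padicValRat_nonneg W hgo hf (hper₀ f hf ϖ hϖ))
    hr hgo hP h2 hΦ

/-- **α-go END-STATE per pair, certificate discharged: `BSD(E,2)` on the Prop. 5.14 locus from the
period inequality and the lower half (PROVED).** As `bsdp_two_of_prop514_of_lowerBound` with `hint`
replaced by `hper₀ : 0 ≤ ord₂ ϖ`. Remaining per-pair inputs: PRINT + `hper₀` + `MissingLowerBoundAt W 2`.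
Nothing is booked. [cite: GreenbergLNM1716, Prop. 5.14 (p. 121)] [cite: Miller2011LMS, Def. 1.1 and §1]
[cite: MazurTateTeitelbaum1986Invent, §I.12] -/
theorem bsdp_two_of_prop514_of_lowerBound_auto (h514 : prop514_isTorsion_mu_eq_zero_two)
    (hEC : TwoAdicEulerCharRankZero W 0) (hmod : nonempty_modularParametrizationData)
    (hGZK : rank_eq_analyticRank_of_analyticRank_le_one)
    (h17 : ∀ [NeZero (W.conductorNorm ℤ)] (f : CuspForm (Gamma0 (W.conductorNorm ℤ)) 2),
      kato_divisibility_allPrimes W 2 (f := f))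
    (hper₀ : ∀ [NeZero (W.conductorNorm ℤ)] (f : CuspForm (Gamma0 (W.conductorNorm ℤ)) 2),
      IsNewformOf W f → ∀ ϖ : ℚ, (ϖ : ℝ) * W.realPeriodRat = plusPeriod f → 0 ≤ padicValRat 2 ϖ)
    (hr : W.analyticRank = 0) (hgo : GoodOrd W 2) {x y : ℚ} (hP : W.toAffine.Equation x y)
    (h2 : 2 * y + W.a₁ * x + W.a₃ = 0)
    (hΦ : (TwoTorsionRamifiedAtTwo x ∧ ¬ TwoTorsionOdd W x) ∨
      (TwoTorsionOdd W x ∧ ¬ TwoTorsionRamifiedAtTwo x))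
    (hlow : MissingLowerBoundAt W 2) : BSDp W 2 :=
  bsdp_two_of_prop514_of_lowerBound W h514 hEC hmod hGZK h17
    (fun f hf ϖ hϖ =>
      exists_integral_mul_padicLFunction_two_of_padicValRat_nonneg W hgo hf (hper₀ f hf ϖ hϖ))
    hr hgo hP h2 hΦ hlow

/-! ## §3 With slack `m`: `−m ≤ ord₂ ϖ` -/

/-- **α-go with slack `m` from the period inequality (PROVED).** As
`upperBoundAtTwo_of_mu_eq_zero_of_slack` with the certificate `hint` (normaliser `ϖ′`, slack `m`)
discharged by `hper_m : −m ≤ ord₂ ϖ` (INT2-AUTO, `ϖ′ = 2^m ϖ`): rank `0`, good ordinary `2`,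
`μ = 0` for the cyclotomic data ⇒ `∃ q, #Ш_an = q ∧ ord₂ #Ш ≤ ord₂ q + m`.
[cite: Kato2004Asterisque, Thm. 17.4 (1)(2) (p. 273)] [cite: MazurTateTeitelbaum1986Invent, §I.12] -/
theorem upperBoundAtTwo_of_mu_eq_zero_of_slack_auto (hEC : TwoAdicEulerCharRankZero W 0)
    (hmod : nonempty_modularParametrizationData)
    (hGZK : rank_eq_analyticRank_of_analyticRank_le_one) (m : ℕ)
    (h17 : ∀ [NeZero (W.conductorNorm ℤ)] (f : CuspForm (Gamma0 (W.conductorNorm ℤ)) 2),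
      kato_divisibility_allPrimes W 2 (f := f))
    (hμ : ∀ (κ : ZpExtension ℚ 2) (γ : Field.absoluteGaloisGroup ℚ), κ.IsCyclotomic →
      κ.IsTopGenerator γ → IsCyclotomicVariable 2 γ → ∀ D : W.SelmerDualData κ γ, D.mu = 0)
    (hper_m : ∀ [NeZero (W.conductorNorm ℤ)] (f : CuspForm (Gamma0 (W.conductorNorm ℤ)) 2),
      IsNewformOf W f → ∀ ϖ : ℚ, (ϖ : ℝ) * W.realPeriodRat = plusPeriod f →
        -(m : ℤ) ≤ padicValRat 2 ϖ)
    (hr : W.analyticRank = 0) (hgo : GoodOrd W 2) :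
    ∃ q : ℚ, shaAn W = (q : ℂ) ∧ (padicValNat 2 W.shaOrder : ℤ) ≤ padicValRat 2 q + m :=
  upperBoundAtTwo_of_mu_eq_zero_of_slack W hEC hmod hGZK m h17 hμ
    (fun f hf ϖ hϖ =>
      exists_integral_mul_padicLFunction_two_of_slack W hgo hf hϖ m (hper_m f hf ϖ hϖ))
    hr hgo

/-- **α-go at slack one from `−1 ≤ ord₂ ϖ` ⇒ `BSD(E,2)` via G9 (PROVED)** (Cassels–Tate `hCT`,
evenness certificate `heven`, lower half `hlow`; as `bsdp_two_of_mu_eq_zero_of_slack_one` with `hint`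
discharged). [cite: Miller2011LMS, Def. 1.1] [cite: SilvermanAEC2009, Thm. X.4.14]
[cite: MazurTateTeitelbaum1986Invent, §I.12] -/
theorem bsdp_two_of_mu_eq_zero_of_slack_one_auto (hCT : exists_casselsTate_pairing (K := ℚ))
    (hEC : TwoAdicEulerCharRankZero W 0) (hmod : nonempty_modularParametrizationData)
    (hGZK : rank_eq_analyticRank_of_analyticRank_le_one)
    (h17 : ∀ [NeZero (W.conductorNorm ℤ)] (f : CuspForm (Gamma0 (W.conductorNorm ℤ)) 2),
      kato_divisibility_allPrimes W 2 (f := f))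
    (hμ : ∀ (κ : ZpExtension ℚ 2) (γ : Field.absoluteGaloisGroup ℚ), κ.IsCyclotomic →
      κ.IsTopGenerator γ → IsCyclotomicVariable 2 γ → ∀ D : W.SelmerDualData κ γ, D.mu = 0)
    (hper₁ : ∀ [NeZero (W.conductorNorm ℤ)] (f : CuspForm (Gamma0 (W.conductorNorm ℤ)) 2),
      IsNewformOf W f → ∀ ϖ : ℚ, (ϖ : ℝ) * W.realPeriodRat = plusPeriod f → -1 ≤ padicValRat 2 ϖ)
    (hcm : ¬ W.HasCM) (hr : W.analyticRank = 0) (hgo : GoodOrd W 2)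
    (heven : ShaAnTwoAdicValEven W) (hlow : MissingLowerBoundAt W 2) : BSDp W 2 :=
  bsdp_two_of_mu_eq_zero_of_slack_one W hCT hEC hmod hGZK h17 hμ
    (fun f hf ϖ hϖ => by
      have h := exists_integral_mul_padicLFunction_two_of_slack W hgo hf hϖ 1
        (by simpa using hper₁ f hf ϖ hϖ)
      simpa using h)
    hcm hr hgo heven hlow

end Summit.BirchSwinnertonDyer.Rank1Residual.X5.O1

end
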